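import Literature.NumberTheory.LFunctions.YoshidaWindowGramColumns
import HarnessLib

/-!
# Kernel enclosures of Yoshida's matrix coefficients — V: column tables and the Schur matrix of the data front door

Source: H. Yoshida, Adv. Stud. Pure Math. **21** (1992) 281–325, §§5–7 [Yoshida1992HermitianForms].  The format-C
front door `WeilFormatC.weilPositivityOn_of_formatC_data` (Summits, rh-explicit weil-10) asks per sector for ONE kernel
fact: the real matrix `S(i,j) = M(i,j) − Σ_{m∈Ico B B₃} M(i,m)M(j,m)/w_m − U₂(i,j)` (`M` the sector kernel of
`gramCoeff a`, thousands of coupling columns `m`, `U₂` an explicit order-1 tail matrix) is positive semidefinite,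
via `PsdDyadic.psd_of_checkPsdMid`, i.e. via an entrywise ENCLOSURE of `S`.  This file supplies the column side at
scale:

* LIGHT column records (`Encl.idxRecCol`: `ω_m`, `1/(1+4ω_m²)`, `Re/Im ψ(¼+iω_m/2)`, `archExpSumSin`, phases —
  no `ψ′`, no diagonal exponential sum), their validity `Encl.ColValid`, the slice checker `Encl.checkTableCol` and
  `Encl.TabColValid`;
* column entry boxes `Encl.evenColBox` / `Encl.oddColBox` (row mode from the full table, column mode from the light
  table) with `mem` theorems, and the column list `Encl.colList`;
* the Schur-row checker `Encl.checkFrontRows` over a PRECOMPUTED column list with a constant dyadic weight `w = wz·2^{−cd}`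
  and an enclosed `U₂` given as a box-valued function, and its soundness `Encl.near_front_of_check`:
  `|S(i,j) − DS_{ij}·2^{−c}| ≤ ρ·2^{−c}`.
Everything is proved; no named facts.
-/

open Real Complex Finset Matrix
open scoped BigOperators

namespace Literature.NumberTheory.LFunctions.Yoshida1992

open Literature.Analysis.SpecialFunctions Literature.Analysis.ValidatedNumerics.NumericsMP
open Literature.Analysis.ValidatedNumerics

namespace Encl

variable {S : ℕ} {a : ℝ} {prm : Params} {ks : List PrimeLen} {C : Consts}

/-! ## Light column records -/

/-- Validity of a LIGHT record at the mode `m`: the off-diagonal fields and `Re ψ(¼ + iω_m/2)`.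
[cite: Moore1966, Ch. 3 (interval arithmetic: inclusion property)] -/
def ColValid (S : ℕ) (a : ℝ) (ks : List PrimeLen) (m : ℕ) (R : IdxRec) : Prop :=
  OffValid S a ks m R ∧ MI.mem S (reDigammaQuarter (freq a m)) R.reP

/-- **The light record at the mode `n`**: as `idxRec` without `ψ′` and the diagonal exponential sum (the two
expensive / unused fields are set to `0`). [cite: Yoshida1992HermitianForms, §5 (5.16) p. 301] -/
def idxRecCol (prm : Params) (C : Consts) (n : ℕ) : Option IdxRec :=
  match MI.divPos prm.S (C.P.mulInt n) C.A with
  | none => none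
  | some om =>
    match MI.divPos prm.S (MI.ofInt prm.S 1) ((MI.ofInt prm.S 1).add ((om.sqr prm.S).mulInt 4)),
          MC.digammaBox prm.S prm.Kser prm.J C.P MC.bernoulliTable (quarterBox prm.S om) with
    | some c, some Ψ =>
      match ssum prm.S om (om.sqr prm.S) 0 C.eks,
            omap (fun L ↦ MC.expI prm.S prm.Kser prm.kred C.P (om.mul prm.S L)) C.lens with
      | some eS, some cs => some ⟨om, c, Ψ.im, eS.widen C.tailE, cs, Ψ.re, MI.ofInt prm.S 0, MI.ofInt prm.S 0⟩
      | _, _ => none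
    | _, _ => none

/-- **`idxRecCol` is valid.** [cite: Moore1966, Ch. 3 (interval arithmetic: inclusion property)] -/
theorem colValid_of_idxRecCol (hS : 0 < prm.S) (ha0 : 0 < a) (hC : ConstsValid prm.S a ks C) {n : ℕ} {R : IdxRec}
    (h : idxRecCol prm C n = some R) : ColValid prm.S a ks n R := by
  unfold idxRecCol at h
  split at h
  · simp at h
  · rename_i om hom
    split at h
    · rename_i c Ψ hc hΨ
      split at h
      · rename_i eS cs heS hcs
        simp only [Option.some.injEq] at h
        subst h
        have hω : MI.mem prm.S (freq a n) om := by
          refine mem_of_eq (MI.mem_divPos hS hom (MI.mem_mulInt hC.pi n) hC.ha) ?_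
          unfold freq; push_cast; ring
        have hω2 : MI.mem prm.S (freq a n ^ 2) (om.sqr prm.S) := MI.mem_sqr hS hω
        have hW := mem_quarterBox (S := prm.S) hω
        have hψ := MC.mem_digammaBox_table hS hC.pi hΨ hW
        have heS' := mem_ssum (a := a) hS hω hω2 C.eks 0 (fun i hi ↦ by simpa using hC.eks i hi) heS
        simp only [Nat.zero_add] at heS'
        have htailS : |archExpSumSin a n - ∑ i ∈ Finset.range C.eks.length, sinTerm a n i| * prm.S ≤ C.tailE :=
          le_trans (mul_le_mul_of_nonneg_right (abs_archExpSumSin_sub_sum_le ha0 n _) (Nat.cast_nonneg _)) hC.tail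
        obtain ⟨hcsl, hcsi⟩ := omap_spec hcs
        refine ⟨{ om := hω, c := ?_, imP := hψ.2, eS := MI.mem_widen heS' htailS,
                  cs_len := by rw [hcsl, hC.lens_len], cs := ?_ }, hψ.1⟩
        · refine mem_of_eq (MI.mem_divPos hS hc (MI.mem_ofInt prm.S 1)
            (MI.mem_add (MI.mem_ofInt prm.S 1) (MI.mem_mulInt hω2 4))) ?_
          push_cast; ring
        · intro i hi
          rw [← hC.lens_len] at hi
          exact MC.mem_expI hS hC.pi (hcsi i hi) (MI.mem_mul hS hω (hC.lens i (hC.lens_len ▸ hi)))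
      · simp at h
    · simp at h

/-- Containment of the light fields. [cite: Moore1966, Ch. 3 (interval arithmetic: inclusion property)] -/
def IdxRec.withinCol (R T : IdxRec) : Bool :=
  Encl.within R.om T.om && Encl.within R.c T.c && Encl.within R.imP T.imP && Encl.within R.eS T.eS &&
    withinLC R.cs T.cs && Encl.within R.reP T.reP

/-- [cite: Moore1966, Ch. 3 (interval arithmetic: inclusion property)] -/
theorem ColValid.of_within {m : ℕ} {R T : IdxRec} (h : IdxRec.withinCol R T = true) (hR : ColValid S a ks m R) :
    ColValid S a ks m T := by
  simp only [IdxRec.withinCol, Bool.and_eq_true] at h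
  obtain ⟨⟨⟨⟨⟨hom, hc⟩, himP⟩, heS⟩, hcs⟩, hreP⟩ := h
  obtain ⟨hcl, hci⟩ := withinLC_spec hcs
  obtain ⟨hO, hre⟩ := hR
  exact ⟨{ om := mem_of_within hom hO.om, c := mem_of_within hc hO.c, imP := mem_of_within himP hO.imP,
           eS := mem_of_within heS hO.eS, cs_len := by rw [hcl, hO.cs_len],
           cs := fun i hi ↦ memC_of_withinC (hci i (by rw [hO.cs_len]; exact hi)) (hO.cs i hi) },
         mem_of_within hreP hre⟩

/-- Check the light table on the modes `n0 ≤ m < n0 + k`. [cite: Moore1966, Ch. 3 (interval arithmetic: inclusion property)] -/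
def checkTableCol (prm : Params) (C : Consts) (ctab : List IdxRec) (n0 k : ℕ) : Bool :=
  (List.range k).all fun i ↦
    match idxRecCol prm C (n0 + i) with
    | some R => IdxRec.withinCol R (tget ctab (n0 + i))
    | none => false

/-- **Soundness of `checkTableCol`.** [cite: Moore1966, Ch. 3 (interval arithmetic: inclusion property)] -/
theorem colValid_of_checkTableCol (hS : 0 < prm.S) (ha0 : 0 < a) (hC : ConstsValid prm.S a ks C)
    {ctab : List IdxRec} {n0 k : ℕ} (h : checkTableCol prm C ctab n0 k = true) {m : ℕ} (hm : n0 ≤ m)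
    (hmk : m < n0 + k) : ColValid prm.S a ks m (tget ctab m) := by
  unfold checkTableCol at h
  rw [List.all_eq_true] at h
  have hi := h (m - n0) (List.mem_range.mpr (by omega))
  rw [show n0 + (m - n0) = m by omega] at hi
  split at hi
  · rename_i R hR; exact ColValid.of_within hi (colValid_of_idxRecCol hS ha0 hC hR)
  · simp at hi

/-- A light table is valid on `[lo, hi)`. [cite: Moore1966, Ch. 3 (interval arithmetic: inclusion property)] -/
def TabColValid (S : ℕ) (a : ℝ) (ks : List PrimeLen) (lo hi : ℕ) (ctab : List IdxRec) : Prop :=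
  ∀ m, lo ≤ m → m < hi → ColValid S a ks m (tget ctab m)

/-- Glue consecutive certified slices. [cite: Moore1966, Ch. 3 (interval arithmetic: inclusion property)] -/
theorem TabColValid.extend {lo up k : ℕ} {ctab : List IdxRec} (h1 : TabColValid S a ks lo up ctab)
    (h2 : ∀ m, up ≤ m → m < up + k → ColValid S a ks m (tget ctab m)) : TabColValid S a ks lo (up + k) ctab :=
  fun m hm hmk ↦ if h : m < up then h1 m hm h else h2 m (by omega) hmk

/-- The empty range. [cite: Moore1966, Ch. 3 (interval arithmetic: inclusion property)] -/
theorem TabColValid.empty {lo : ℕ} {ctab : List IdxRec} : TabColValid S a ks lo lo ctab :=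
  fun _ h1 h2 ↦ absurd h2 (by omega)

/-! ## Column entry boxes (row mode from the full table, column mode from the light table) -/

/-- Box of the even coupling entry `M⁺(i,m)` for a column mode `m ≥ 1`. [cite: Yoshida1992HermitianForms, §6 (6.10) p. 303] -/
def evenColBox (S : ℕ) (C : Consts) (tab ctab : List IdxRec) (i m : ℕ) : MI :=
  if i = 0 then gramBox S C (tget tab 0) (tget ctab m) 0 m
  else ((gramBox S C (tget tab i) (tget ctab m) i m).add (gramBox S C (tget tab i) (tget ctab m).flip i (-(m : ℤ)))).divNat 2

/-- Box of the odd coupling entry `M⁻(k,l)`. [cite: Yoshida1992HermitianForms, §6 (6.10) p. 303] -/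
def oddColBox (S : ℕ) (C : Consts) (tab ctab : List IdxRec) (k l : ℕ) : MI :=
  ((gramBox S C (tget tab (k + 1)) (tget ctab (l + 1)) ((k : ℤ) + 1) ((l : ℤ) + 1)).sub
    (gramBox S C (tget tab (k + 1)) (tget ctab (l + 1)).flip ((k : ℤ) + 1) (-((l : ℤ) + 1)))).divNat 2

/-- The sector coupling box. [cite: Yoshida1992HermitianForms, §6 (6.10) p. 303] -/
def sectorColBox (odd : Bool) (S : ℕ) (C : Consts) (tab ctab : List IdxRec) (i m : ℕ) : MI :=
  if odd then oddColBox S C tab ctab i m else evenColBox S C tab ctab i m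

variable {tab ctab : List IdxRec} {N lo up : ℕ}

/-- `evenColBox ∋ M⁺(i,m)` for `i < N` (full table) and a column mode `m ≥ 1` in the light range, `m ≠ i`.
[cite: Moore1966, Ch. 3 (interval arithmetic: inclusion property)] -/
theorem mem_evenColBox (hS : 0 < S) (ha0 : 0 < a) (hks : PrimeData a ks) (hC : ConstsValid S a ks C)
    (hT : TabValid S a ks N tab) (hCT : TabColValid S a ks lo up ctab) {i m : ℕ} (hi : i < N) (hm1 : lo ≤ m)
    (hm2 : m < up) (hm0 : m ≠ 0) (him : i < m) :
    MI.mem S (evenKernel (gramCoeff a) i m) (evenColBox S C tab ctab i m) := by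
  unfold evenKernel evenColBox
  have hmO := (hCT m hm1 hm2).1
  by_cases hi0 : i = 0
  · subst hi0
    simp only [if_true]
    have h0 : 0 < N := by omega
    have := mem_gramBox hS ha0 hks hC (hT 0 h0).1 (fun h ↦ absurd h (by exact_mod_cast hm0.symm)) hmO
    simpa using this
  · simp only [hi0, if_false, hm0]
    have h1 := mem_gramBox hS ha0 hks hC (hT i hi).1 (fun h ↦ absurd h (by exact_mod_cast (ne_of_lt him))) hmO
    have h2 := mem_gramBox hS ha0 hks hC (hT i hi).1 (fun h ↦ absurd h (by omega)) (OffValid.flip hmO)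
    have := MI.mem_divNat (MI.mem_add h1 h2) (n := 2) (by norm_num)
    exact mem_of_eq this (by push_cast; ring)

/-- `oddColBox ∋ M⁻(k,l)` for `k + 1 < N` (full table), `l + 1` in the light range, `k < l`.
[cite: Moore1966, Ch. 3 (interval arithmetic: inclusion property)] -/
theorem mem_oddColBox (hS : 0 < S) (ha0 : 0 < a) (hks : PrimeData a ks) (hC : ConstsValid S a ks C)
    (hT : TabValid S a ks N tab) (hCT : TabColValid S a ks lo up ctab) {k l : ℕ} (hk : k + 1 < N) (hl1 : lo ≤ l + 1)
    (hl2 : l + 1 < up) (hkl : k < l) :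
    MI.mem S (oddKernel (gramCoeff a) k l) (oddColBox S C tab ctab k l) := by
  unfold oddKernel oddColBox
  have ek : ((k + 1 : ℕ) : ℤ) = (k : ℤ) + 1 := by push_cast; ring
  have el : ((l + 1 : ℕ) : ℤ) = (l : ℤ) + 1 := by push_cast; ring
  have hkO := (hT (k + 1) hk).1
  have hlO := (hCT (l + 1) hl1 hl2).1
  rw [ek] at hkO
  rw [el] at hlO
  have h1 := mem_gramBox hS ha0 hks hC hkO (fun h ↦ absurd h (by omega)) hlO
  have h2 := mem_gramBox hS ha0 hks hC hkO (fun h ↦ absurd h (by omega)) (OffValid.flip hlO)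
  have := MI.mem_divNat (MI.mem_sub h1 h2) (n := 2) (by norm_num)
  exact mem_of_eq this (by push_cast; ring)

/-- `sectorColBox ∋ M^σ(i, B + t)` for `i < B ≤ B + t`, table ranges permitting (even: full table valid below `B`,
light table valid on `[B, B+K)`; odd: full below `B + 1`, light on `[B+1, B+K+1)`; uniformly: full below `B + 1`,
light on `[B, B + K + 1)`). [cite: Moore1966, Ch. 3 (interval arithmetic: inclusion property)] -/
theorem mem_sectorColBox (hS : 0 < S) (ha0 : 0 < a) (hks : PrimeData a ks) (hC : ConstsValid S a ks C)
    {B K : ℕ} (hB : 1 ≤ B) (hT : TabValid S a ks (B + 1) tab) (hCT : TabColValid S a ks B (B + K + 1) ctab)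
    (odd : Bool) {i t : ℕ} (hi : i < B) (ht : t < K) :
    MI.mem S (sectorKernel odd (gramCoeff a) i (B + t)) (sectorColBox odd S C tab ctab i (B + t)) := by
  cases odd
  · simpa [sectorKernel, sectorColBox] using
      mem_evenColBox hS ha0 hks hC hT hCT (i := i) (m := B + t) (by omega) (by omega) (by omega) (by omega) (by omega)
  · simpa [sectorKernel, sectorColBox] using
      mem_oddColBox hS ha0 hks hC hT hCT (k := i) (l := B + t) (by omega) (by omega) (by omega) (by omega)

/-! ## The column list and the front-door Schur rows -/

/-- All coupling boxes: row `t` (column mode `B + t`), entry `i < B`. [cite: Moore1966, Ch. 3 (interval arithmetic: inclusion property)] -/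
def colList (odd : Bool) (S : ℕ) (C : Consts) (tab ctab : List IdxRec) (B K : ℕ) : List (List MI) :=
  (List.range K).map fun t ↦ (List.range B).map fun i ↦ sectorColBox odd S C tab ctab i (B + t)

/-- Validity of a column list: entry `(t, i)` contains `M(i, B+t)`. [cite: Moore1966, Ch. 3 (interval arithmetic: inclusion property)] -/
def ColsValid (S : ℕ) (M : ℕ → ℕ → ℝ) (B K : ℕ) (cols : List (List MI)) : Prop :=
  ∀ t < K, ∀ i < B, MI.mem S (M i (B + t)) ((cols.getD t []).getD i default)

/-- `colList` is valid. [cite: Moore1966, Ch. 3 (interval arithmetic: inclusion property)] -/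
theorem colsValid_colList (hS : 0 < S) (ha0 : 0 < a) (hks : PrimeData a ks) (hC : ConstsValid S a ks C)
    {B K : ℕ} (hB : 1 ≤ B) (hT : TabValid S a ks (B + 1) tab) (hCT : TabColValid S a ks B (B + K + 1) ctab)
    (odd : Bool) : ColsValid S (sectorKernel odd (gramCoeff a)) B K (colList odd S C tab ctab B K) := by
  intro t ht i hi
  have e : ((colList odd S C tab ctab B K).getD t []).getD i default = sectorColBox odd S C tab ctab i (B + t) := by
    unfold colList
    simp only [List.getD_eq_getElem?_getD, List.getElem?_map, List.getElem?_range ht, List.getElem?_range hi,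
      Option.map_some, Option.getD_some]
  rw [e]
  exact mem_sectorColBox hS ha0 hks hC hB hT hCT odd hi ht

/-- `Σ_{t<k} cols[t][i]·cols[t][j]·2^{cd}/wz` with ONE constant dyadic weight `w = wz·2^{−cd}`.
[cite: Moore1966, Ch. 3 (interval arithmetic: inclusion property)] -/
def colSumW (S : ℕ) (cols : List (List MI)) (cd : ℕ) (wz : ℕ) (i j : ℕ) : ℕ → MI
  | 0 => MI.ofInt S 0
  | t + 1 => (colSumW S cols cd wz i j t).add
      (((((cols.getD t []).getD i default).mul S ((cols.getD t []).getD j default)).mulInt (2 ^ cd)).divNat wz)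

/-- [cite: Moore1966, Ch. 3 (interval arithmetic: inclusion property)] -/
theorem mem_colSumW (hS : 0 < S) {M : ℕ → ℕ → ℝ} {B K cd wz : ℕ} (hwz : 0 < wz) {cols : List (List MI)}
    (hcols : ColsValid S M B K cols) {i j : ℕ} (hi : i < B) (hj : j < B) :
    ∀ k ≤ K, MI.mem S (∑ t ∈ Finset.range k, M i (B + t) * M j (B + t) / ((wz : ℝ) * (1 / 2 ^ cd)))
      (colSumW S cols cd wz i j k)
  | 0, _ => by simpa [colSumW] using MI.mem_ofInt S 0
  | k + 1, hk => by
      rw [Finset.sum_range_succ, colSumW]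
      have hk' : k < K := hk
      have h := MI.mem_divNat (MI.mem_mulInt (MI.mem_mul hS (hcols k hk' i hi) (hcols k hk' j hj)) (2 ^ cd)) hwz
      refine MI.mem_add (mem_colSumW hS hwz hcols hi hj k (by omega)) (mem_of_eq h ?_)
      have hw : (0 : ℝ) < wz := by exact_mod_cast hwz
      push_cast
      field_simp

/-- The front-door Schur entry box over a precomputed column list: `M(i,j) − Σ_t … /w − U₂(i,j)`.
[cite: Yoshida1992HermitianForms, §7 pp. 305–312 (the finite certificate)] -/
def frontBox (odd : Bool) (S : ℕ) (C : Consts) (tab : List IdxRec) (cols : List (List MI)) (cd wz K : ℕ)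
    (U2 : ℕ → ℕ → MI) (i j : ℕ) : MI :=
  (sectorBoxSym odd S C tab i j).sub ((colSumW S cols cd wz i j K).add (U2 i j))

/-- Check a band of rows of the front-door Schur matrix against the data `DS` (unit `2^{−c}`, radius `ρS`), given
the column list. [cite: Moore1966, Ch. 3 (interval arithmetic: inclusion property)] -/
def checkFrontRowsAux (S c : ℕ) (ρS : ℤ) (C : Consts) (tab : List IdxRec) (odd : Bool) (B : ℕ)
    (cols : List (List MI)) (cd wz K : ℕ) (U2 : ℕ → ℕ → MI) (DS : List (List ℤ)) (i0 k : ℕ) : Bool :=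
  decide (0 < wz) &&
    (List.range k).all fun di ↦ (List.range B).all fun j ↦
      enclCheck S c ρS (PsdDyadic.getMZ DS (i0 + di) j) (frontBox odd S C tab cols cd wz K U2 (i0 + di) j)

/-- The real front-door Schur entry with the constant weight. [cite: Yoshida1992HermitianForms, §7 pp. 305–312 (the finite certificate)] -/
noncomputable def frontEntry (M : ℕ → ℕ → ℝ) (B K cd wz : ℕ) (U₂ : ℕ → ℕ → ℝ) (i j : ℕ) : ℝ :=
  M i j - (∑ t ∈ Finset.range K, M i (B + t) * M j (B + t) / ((wz : ℝ) * (1 / 2 ^ cd))) - U₂ i j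

/-- **Soundness of `checkFrontRowsAux`** (abstract in the column list and the `U₂` boxes).
[cite: Yoshida1992HermitianForms, §7 pp. 305–312 (the finite certificate)] -/
theorem near_front_of_checkAux (hS : 0 < S) (ha0 : 0 < a) (hks : PrimeData a ks) (hC : ConstsValid S a ks C)
    {B : ℕ} (hT : TabValid S a ks (B + 1) tab) {odd : Bool} {K c cd wz : ℕ} {ρS : ℤ} {cols : List (List MI)}
    (hcols : ColsValid S (sectorKernel odd (gramCoeff a)) B K cols) {U2 : ℕ → ℕ → MI} {U₂ : ℕ → ℕ → ℝ}
    (hU2 : ∀ i < B, ∀ j < B, MI.mem S (U₂ i j) (U2 i j)) {DS : List (List ℤ)} {i0 k : ℕ}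
    (h : checkFrontRowsAux S c ρS C tab odd B cols cd wz K U2 DS i0 k = true)
    {i j : ℕ} (hi : i0 ≤ i) (hik : i < i0 + k) (hiB : i < B) (hj : j < B) :
    |frontEntry (sectorKernel odd (gramCoeff a)) B K cd wz U₂ i j - (PsdDyadic.getMZ DS i j : ℝ) * (1 / 2 ^ c)|
      ≤ (ρS : ℝ) * (1 / 2 ^ c) := by
  simp only [checkFrontRowsAux, Bool.and_eq_true, List.all_eq_true, List.mem_range, decide_eq_true_eq] at h
  obtain ⟨hwz, hrows⟩ := h
  have h2 := hrows (i - i0) (by omega) j hj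
  rw [show i0 + (i - i0) = i by omega] at h2
  refine abs_sub_le_of_enclCheck hS h2 ?_
  unfold frontEntry frontBox
  have hM := mem_sectorBoxSym hS ha0 hks hC hT odd (i := i) (j := j) (by omega) (by omega)
  have hU1 := mem_colSumW hS (cd := cd) hwz hcols hiB hj K le_rfl
  exact mem_of_eq (MI.mem_sub hM (MI.mem_add hU1 (hU2 i hiB j hj))) (by ring)

end Encl

end Literature.NumberTheory.LFunctions.Yoshida1992

/-! # Part V-b: the front door's constants, far-diagonal lower bounds and tail matrices `U₂`

The closed forms below are transcribed VERBATIM from `WeilFormatC.weilPositivityOn_of_formatC_data`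
(Summits/…/WeilFormatCDataRung.lean, rh-explicit weil-10): the even/odd far diagonals `d̂⁺(m)`, `d̂⁻` (core − π/4 form)
and the order-1 tail matrices `U₂⁺`, `U₂⁻`; this file encloses them from the constants, the tables and a few
certified rational data (floors `⌊2a/log k⌋₊`, square-root majorants). -/

namespace Literature.NumberTheory.LFunctions.Yoshida1992

open Literature.Analysis.SpecialFunctions Literature.Analysis.ValidatedNumerics.NumericsMP
open Literature.Analysis.ValidatedNumerics
open scoped ArithmeticFunction.vonMangoldt

namespace Encl

variable {S : ℕ} {a : ℝ} {prm : Params} {ks : List PrimeLen} {C : Consts}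

/-! ## The real constants (verbatim sub-expressions of the front door) -/

/-- `A₁(a) = Σ_{k ∈ weilPrimeIndex a} Λ(k)k^{−1/2}`. [cite: Yoshida1992HermitianForms, §7 p. 305] -/
noncomputable def primeMass (a : ℝ) : ℝ := ∑ k ∈ weilPrimeIndex a, (Λ k : ℝ) / Real.sqrt k

/-- `A_op⁺(a) = Σ_k Λ(k)k^{−1/2}·2cos(π/(⌊2a/log k⌋₊ + 2))` (path-graph bound of the compressed shift).
[cite: Yoshida1992HermitianForms, §7 p. 305] -/
noncomputable def primeOp (a : ℝ) : ℝ :=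
  ∑ k ∈ weilPrimeIndex a, (Λ k : ℝ) / Real.sqrt k * (2 * Real.cos (π / (⌊2 * a / Real.log k⌋₊ + 2)))

/-- The EVEN far diagonal `d̂⁺(m)` of the front door (block `Be`). [cite: Yoshida1992HermitianForms, §7 pp. 305–312] -/
noncomputable def devEven (a : ℝ) (Be m : ℕ) : ℝ :=
  (reDigammaQuarter (freq a m) - Real.log π) / 2 - a * (1 + weilArchDensity (2 * a)) / (π ^ 2 * m ^ 2) - 1 / (8 * m)
    - a * (1 + weilArchDensity (2 * a)) / π ^ 2 * Real.sqrt (8 / ((Be - 1 : ℕ) : ℝ))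
    - (∑ k ∈ weilPrimeIndex a, (Λ k : ℝ) / Real.sqrt k * (2 * Real.cos (π / (⌊2 * a / Real.log k⌋₊ + 2)))) / 2

/-- The ODD far-diagonal CORE minus `π/4` of the front door (block `Bo`; the form of `h0o`/`hd0o`, a lower bound of the
arctan-weighted `d̂⁻`). [cite: Yoshida1992HermitianForms, §7 pp. 305–312] -/
noncomputable def devOdd0 (a : ℝ) (Bo l : ℕ) : ℝ :=
  (reDigammaQuarter (freq a ((l : ℤ) + 1)) - Real.log π) / 2 - 1 / (8 * ((l : ℝ) + 1))
    - a * (1 + weilArchDensity (2 * a)) / (π ^ 2 * ((l : ℝ) + 1) ^ 2) - π / 4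
    - a * (1 + weilArchDensity (2 * a)) / π ^ 2 * Real.sqrt (8 / Bo)
    - (∑ k ∈ weilPrimeIndex a, (Λ k : ℝ) / Real.sqrt k * (2 * Real.cos (π / (⌊2 * a / Real.log k⌋₊ + 2)))) / 2
    - (Real.exp (a / 2) - Real.exp (-(a / 2))) ^ 2 * a / (π ^ 2 * Bo)

/-- The EVEN order-1 tail matrix `U₂⁺(i,j)` of the front door. [cite: Yoshida1992HermitianForms, §7 pp. 305–312] -/
noncomputable def U2Even (a θ d0 : ℝ) (Be B3e : ℕ) (i j : ℕ) : ℝ :=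
  (1 + θ) * ((1 + 4 / π * (∑ k ∈ weilPrimeIndex a, (Λ k : ℝ) / Real.sqrt k)) / 4) ^ 2 / (d0 * ((B3e - 1 : ℕ) : ℝ)) *
      ((-1 : ℝ) ^ i * (-1 : ℝ) ^ j) +
    (if i = j then (1 + θ⁻¹) * (Be / (d0 * ((B3e : ℝ) ^ 2 * ((B3e - 1 : ℕ) : ℝ)))) *
      ((Real.exp (a / 2) - Real.exp (-(a / 2))) ^ 2 * a / π ^ 2 +
        2 * i * (∑ k ∈ weilPrimeIndex a, (Λ k : ℝ) / Real.sqrt k) / π +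
          ((i : ℝ) / 2 + 8 * a * (1 + weilArchDensity (2 * a)) / (3 * π ^ 2))) ^ 2 else 0)

/-- The odd direction vector `v⁻(k)` (mode `k + 1`) of the front door. [cite: Yoshida1992HermitianForms, §7 pp. 305–312] -/
noncomputable def vOdd (a : ℝ) (k : ℕ) : ℝ :=
  (-1 : ℝ) ^ (k + 1) *
    (-(4 * (Real.exp (a / 2) - Real.exp (-(a / 2))) ^ 2 * (freq a ((k : ℤ) + 1) / (1 + 4 * freq a ((k : ℤ) + 1) ^ 2)) / π) -
      (∑ j ∈ weilPrimeIndex a, (Λ j : ℝ) / Real.sqrt j * Real.sin (freq a ((k : ℤ) + 1) * Real.log j)) / π -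
      (Complex.digamma (1 / 4 + ((freq a ((k : ℤ) + 1) : ℝ) : ℂ) / 2 * I)).im / (2 * π) + archExpSumSin a ((k : ℤ) + 1) / π)

/-- The ODD order-1 tail matrix `U₂⁻(k,k')`. [cite: Yoshida1992HermitianForms, §7 pp. 305–312] -/
noncomputable def U2Odd (a θ d0 : ℝ) (Bo B3o : ℕ) (k k' : ℕ) : ℝ :=
  (1 + θ) * (1 / (d0 * B3o)) * (vOdd a k * vOdd a k') +
    (if k = k' then (1 + θ⁻¹) * (Bo / (d0 * ((((B3o : ℝ) + 1) ^ 2) * (B3o : ℝ)))) *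
      ((Real.exp (a / 2) - Real.exp (-(a / 2))) ^ 2 * a ^ 2 / (4 * π ^ 3) + 2 * ((k : ℕ) + 1 : ℕ) *
        (∑ j ∈ weilPrimeIndex a, (Λ j : ℝ) / Real.sqrt j) / π +
          ((((k : ℕ) + 1 : ℕ) : ℝ) / 2 + 4 * a * (1 + weilArchDensity (2 * a)) / (3 * π ^ 2))) ^ 2 else 0)

/-! ## Prime sums over the prime data -/

/-- Any weighted prime sum over the window is the corresponding list sum over the prime data.
[cite: Yoshida1992HermitianForms, §5 (5.15) p. 301] -/
theorem sum_weilPrimeIndex_eq_listSum (h : PrimeData a ks) (g : ℕ → ℝ) :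
    ∑ k ∈ weilPrimeIndex a, (Λ k : ℝ) / Real.sqrt k * g k = (ks.map fun q ↦ q.wt * g q.val).sum := by
  have step1 : ∑ k ∈ weilPrimeIndex a, (Λ k : ℝ) / Real.sqrt k * g k
      = ∑ k ∈ (weilPrimeIndex a).filter IsPrimePow, (Λ k : ℝ) / Real.sqrt k * g k := by
    refine (Finset.sum_filter_of_ne fun k _ hne ↦ ?_).symm
    by_contra hk
    rw [ArithmeticFunction.vonMangoldt_eq_zero_iff.mpr hk] at hne
    simp at hne
  have step2 : (weilPrimeIndex a).filter IsPrimePow = (ks.map PrimeLen.val).toFinset := by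
    ext k
    simp only [Finset.mem_filter, List.mem_toFinset]
    constructor
    · rintro ⟨hk, hpp⟩; exact (h.mem_iff k hpp).1 hk
    · intro hk
      have hpp : IsPrimePow k := by
        obtain ⟨q, hq, rfl⟩ := List.mem_map.1 hk
        exact PrimeLen.isPrimePow_val (h.prime q hq)
      exact ⟨(h.mem_iff k hpp).2 hk, hpp⟩
  rw [step1, step2, List.sum_toFinset _ h.nodup, List.map_map]
  congr 1
  refine List.map_congr_left fun q hq ↦ ?_
  simp only [Function.comp_apply]
  rw [PrimeLen.vonMangoldt_div_sqrt_val (h.prime q hq)]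

/-- `Σ_{i<k} wts_i` (the prime mass over the data). [cite: Moore1966, Ch. 3 (interval arithmetic: inclusion property)] -/
def wtSum (wts : List MI) : ℕ → MI
  | 0 => MI.ofInt 1 0
  | i + 1 => (wtSum wts i).add (wts.getD i default)

/-- [cite: Moore1966, Ch. 3 (interval arithmetic: inclusion property)] -/
theorem mem_wtSum (hC : ConstsValid S a ks C) :
    ∀ k, k ≤ ks.length → MI.mem S (∑ i ∈ Finset.range k, (ks.getD i default).wt) (wtSum C.wts k)
  | 0, _ => by simp [wtSum, MI.ofInt, MI.mem]
  | k + 1, hk => by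
      rw [Finset.sum_range_succ, wtSum]
      exact MI.mem_add (mem_wtSum hC k (by omega)) (hC.wts k hk)

/-- `primeMass a ∈ wtSum C.wts |ks|`. [cite: Moore1966, Ch. 3 (interval arithmetic: inclusion property)] -/
theorem mem_primeMass (hks : PrimeData a ks) (hC : ConstsValid S a ks C) :
    MI.mem S (primeMass a) (wtSum C.wts ks.length) := by
  have e : primeMass a = ∑ i ∈ Finset.range ks.length, (ks.getD i default).wt := by
    unfold primeMass
    have h := sum_weilPrimeIndex_eq_listSum hks (fun _ ↦ (1 : ℝ))
    simp only [mul_one] at h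
    rw [h, list_sum_map_eq_sum_range]
  rw [e]; exact mem_wtSum hC ks.length le_rfl

/-- `Σ_{i<k} wts_i · 2cos(π/(ns_i + 2))` (the compressed-shift bound over the data, floors supplied).
[cite: Moore1966, Ch. 3 (interval arithmetic: inclusion property)] -/
def opSum (S Kser kred : ℕ) (P : MI) (wts : List MI) (ns : List ℕ) : ℕ → Option MI
  | 0 => some (MI.ofInt S 0)
  | i + 1 =>
    match opSum S Kser kred P wts ns i, MC.expI S Kser kred P (P.divNat (ns.getD i 0 + 2)) with
    | some acc, some z => some (acc.add (((wts.getD i default).mul S z.re).mulInt 2))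
    | _, _ => none

/-- [cite: Moore1966, Ch. 3 (interval arithmetic: inclusion property)] -/
theorem mem_opSum (hS : 0 < S) {Kser kred : ℕ} {P : MI} (hP : MI.mem S Real.pi P) (hC : ConstsValid S a ks C)
    (ns : List ℕ) : ∀ k, k ≤ ks.length → ∀ {Y : MI}, opSum S Kser kred P C.wts ns k = some Y →
      MI.mem S (∑ i ∈ Finset.range k, (ks.getD i default).wt * (2 * Real.cos (π / (ns.getD i 0 + 2)))) Y
  | 0, _, Y, h => by
      simp only [opSum, Option.some.injEq] at h
      subst h; simpa using MI.mem_ofInt S 0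
  | k + 1, hk, Y, h => by
      simp only [opSum] at h
      split at h
      · rename_i acc z hacc hz
        simp only [Option.some.injEq] at h
        subst h
        rw [Finset.sum_range_succ]
        have hθ : MI.mem S (π / (ns.getD k 0 + 2 : ℕ)) (P.divNat (ns.getD k 0 + 2)) := MI.mem_divNat hP (by omega)
        have hz' := (MC.mem_expI hS hP hz hθ).1
        rw [Complex.exp_ofReal_mul_I_re] at hz'
        have hcos : MI.mem S (Real.cos (π / (ns.getD k 0 + 2))) z.re := by
          refine mem_of_eq hz' ?_; push_cast; ring_nf
        exact MI.mem_add (mem_opSum hS hP hC ns k (by omega) hacc)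
          (mem_of_eq (MI.mem_mulInt (MI.mem_mul hS (hC.wts k hk) hcos) 2) (by push_cast; ring))
      · simp at h

/-- Floor certificate: `ns_i = ⌊2a/ℓ_i⌋₊` by strict separation `ns_i·ℓ_i < 2a < (ns_i+1)·ℓ_i`.
[cite: Moore1966, Ch. 3 (interval arithmetic: inclusion property)] -/
def checkFloors (A : MI) (lens : List MI) (ns : List ℕ) (k : ℕ) : Bool :=
  (List.range k).all fun i ↦
    decide (0 < (lens.getD i default).lo) &&
    decide (((lens.getD i default).mulInt (ns.getD i 0)).hi < (A.mulInt 2).lo) &&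
    decide ((A.mulInt 2).hi < ((lens.getD i default).mulInt (ns.getD i 0 + 1)).lo)

/-- [cite: Moore1966, Ch. 3 (interval arithmetic: inclusion property)] -/
theorem floor_eq_of_checkFloors (hC : ConstsValid S a ks C) {ns : List ℕ} {k : ℕ}
    (h : checkFloors C.A C.lens ns k = true) : ∀ i < k, i < ks.length →
      ⌊2 * a / (ks.getD i default).len⌋₊ = ns.getD i 0 := by
  intro i hi hik
  simp only [checkFloors, List.all_eq_true, List.mem_range, Bool.and_eq_true, decide_eq_true_eq] at h
  obtain ⟨⟨hpos, hlo⟩, hhi⟩ := h i hi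
  have hlen := hC.lens i hik
  have h2a : MI.mem S (2 * a) (C.A.mulInt 2) := mem_of_eq (MI.mem_mulInt hC.ha 2) (by push_cast; ring)
  have hℓ : 0 < (ks.getD i default).len := MI.pos_of_lo_pos hlen hpos
  have h1 : (ks.getD i default).len * (ns.getD i 0 : ℕ) < 2 * a :=
    MI.lt_of_hi_lt_lo (MI.mem_mulInt hlen _) h2a (by exact_mod_cast hlo)
  have h2 : 2 * a < (ks.getD i default).len * (ns.getD i 0 + 1 : ℕ) :=
    MI.lt_of_hi_lt_lo h2a (MI.mem_mulInt hlen _) (by exact_mod_cast hhi)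
  have hpos2a : 0 ≤ 2 * a := by
    have : (0 : ℝ) ≤ (ks.getD i default).len * ((ns.getD i 0 : ℕ) : ℝ) := by positivity
    linarith
  rw [Nat.floor_eq_iff (div_nonneg hpos2a hℓ.le)]
  constructor
  · rw [le_div_iff₀ hℓ]; linarith
  · rw [div_lt_iff₀ hℓ]; push_cast at h2 ⊢; linarith

/-- `primeOp a` as a list sum with certified floors. [cite: Moore1966, Ch. 3 (interval arithmetic: inclusion property)] -/
theorem mem_primeOp (hS : 0 < S) (hks : PrimeData a ks) (hC : ConstsValid S a ks C) {Kser kred : ℕ}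
    {ns : List ℕ} (hfl : checkFloors C.A C.lens ns ks.length = true) {Y : MI}
    (h : opSum S Kser kred C.P C.wts ns ks.length = some Y) : MI.mem S (primeOp a) Y := by
  have e : primeOp a = ∑ i ∈ Finset.range ks.length, (ks.getD i default).wt * (2 * Real.cos (π / (ns.getD i 0 + 2))) := by
    unfold primeOp
    rw [sum_weilPrimeIndex_eq_listSum hks, list_sum_map_eq_sum_range]
    refine Finset.sum_congr rfl fun i hi ↦ ?_
    rw [PrimeLen.log_val, floor_eq_of_checkFloors hC hfl i (Finset.mem_range.mp hi) (Finset.mem_range.mp hi)]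
  rw [e]; exact mem_opSum hS hC.pi hC ns ks.length le_rfl h

/-! ## The front-door constants record -/

/-- Constants of the front door (enclosures at scale `S`). [cite: Moore1966, Ch. 3 (interval arithmetic: inclusion property)] -/
structure FDConsts where
  /-- `weilArchDensity (2a) = e^{a}/(e^{2a} − e^{−2a})` -/
  E2 : MI
  /-- `a(1 + weilArchDensity (2a))` -/
  Ca : MI
  /-- `primeMass a` -/
  A1 : MI
  /-- `primeOp a` -/
  Aop : MI
  /-- `(e^{a/2} − e^{−a/2})²` -/
  s2 : MI
  /-- `1/π²` -/
  invPi2 : MI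
  deriving Repr, Inhabited

/-- Validity of the front-door constants. [cite: Moore1966, Ch. 3 (interval arithmetic: inclusion property)] -/
structure FDValid (S : ℕ) (a : ℝ) (F : FDConsts) : Prop where
  /-- `weilArchDensity (2a) ∈ E2` -/
  E2 : MI.mem S (weilArchDensity (2 * a)) F.E2
  /-- `a(1+weilArchDensity(2a)) ∈ Ca` -/
  Ca : MI.mem S (a * (1 + weilArchDensity (2 * a))) F.Ca
  /-- `primeMass a ∈ A1` -/
  A1 : MI.mem S (primeMass a) F.A1
  /-- `primeOp a ∈ Aop` -/
  Aop : MI.mem S (primeOp a) F.Aop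
  /-- `(e^{a/2} − e^{−a/2})² ∈ s2` -/
  s2 : MI.mem S ((Real.exp (a / 2) - Real.exp (-(a / 2))) ^ 2) F.s2
  /-- `1/π² ∈ invPi2` -/
  invPi2 : MI.mem S (1 / π ^ 2) F.invPi2

/-- Compute the front-door constants. [cite: Moore1966, Ch. 3 (interval arithmetic: inclusion property)] -/
def fdConsts (prm : Params) (C : Consts) (nks : ℕ) (ns : List ℕ) : Option FDConsts :=
  match MI.exp prm.S prm.Kser prm.kred C.A, MI.exp prm.S prm.Kser prm.kred (C.A.mulInt 2),
        MI.exp prm.S prm.Kser prm.kred ((C.A.mulInt 2).neg) with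
  | some E1, some Ep, some Em =>
    match MI.divPos prm.S E1 (Ep.sub Em), MI.exp prm.S prm.Kser prm.kred (C.A.divNat 2),
          MI.exp prm.S prm.Kser prm.kred ((C.A.divNat 2).neg) with
    | some E2, some Hp, some Hm =>
      match opSum prm.S prm.Kser prm.kred C.P C.wts ns nks with
      | some Aop => some ⟨E2, C.A.mul prm.S ((MI.ofInt prm.S 1).add E2), wtSum C.wts nks, Aop, (Hp.sub Hm).sqr prm.S,
          C.invPi.mul prm.S C.invPi⟩
      | none => none
    | _, _, _ => none
  | _, _, _ => none

/-- **`fdConsts` is valid** (with certified floors). [cite: Moore1966, Ch. 3 (interval arithmetic: inclusion property)] -/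
theorem fdValid_of_fdConsts (hS : 0 < prm.S) (hks : PrimeData a ks) (hC : ConstsValid prm.S a ks C)
    {ns : List ℕ} (hfl : checkFloors C.A C.lens ns ks.length = true) {F : FDConsts}
    (h : fdConsts prm C ks.length ns = some F) : FDValid prm.S a F := by
  unfold fdConsts at h
  split at h
  · rename_i E1 Ep Em hE1 hEp hEm
    split at h
    · rename_i E2 Hp Hm hE2 hHp hHm
      split at h
      · rename_i Aop hAop
        simp only [Option.some.injEq] at h
        subst h
        have h2a : MI.mem prm.S (2 * a) (C.A.mulInt 2) := mem_of_eq (MI.mem_mulInt hC.ha 2) (by push_cast; ring)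
        have hden : MI.mem prm.S (Real.exp (2 * a) - Real.exp (-(2 * a))) (Ep.sub Em) :=
          MI.mem_sub (MI.mem_exp hS hEp h2a) (MI.mem_exp hS hEm (MI.mem_neg h2a))
        have hE2' : MI.mem prm.S (weilArchDensity (2 * a)) E2 := by
          have := MI.mem_divPos hS hE2 (MI.mem_exp hS hE1 hC.ha) hden
          refine mem_of_eq this ?_
          unfold weilArchDensity
          rw [Real.sinh_eq]
          congr 1
          · congr 1; ring
          · ring
        have ha2 : MI.mem prm.S (a / 2) (C.A.divNat 2) := mem_of_eq (MI.mem_divNat hC.ha (n := 2) (by norm_num)) (by norm_num)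
        refine { E2 := hE2', Ca := ?_, A1 := mem_primeMass hks hC, Aop := mem_primeOp hS hks hC hfl hAop, s2 := ?_, invPi2 := ?_ }
        · exact mem_of_eq (MI.mem_mul hS hC.ha (MI.mem_add (MI.mem_ofInt prm.S 1) hE2')) (by push_cast; ring)
        · exact MI.mem_sqr hS (MI.mem_sub (MI.mem_exp hS hHp ha2) (MI.mem_exp hS hHm (MI.mem_neg ha2)))
        · exact mem_of_eq (MI.mem_mul hS hC.invPi hC.invPi) (by ring)
      · simp at h
    · simp at h
  · simp at h

/-- Containment of front-door constants. [cite: Moore1966, Ch. 3 (interval arithmetic: inclusion property)] -/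
def FDConsts.within (F G : FDConsts) : Bool :=
  Encl.within F.E2 G.E2 && Encl.within F.Ca G.Ca && Encl.within F.A1 G.A1 && Encl.within F.Aop G.Aop &&
    Encl.within F.s2 G.s2 && Encl.within F.invPi2 G.invPi2

/-- [cite: Moore1966, Ch. 3 (interval arithmetic: inclusion property)] -/
theorem FDValid.of_within {F G : FDConsts} (h : FDConsts.within F G = true) (hF : FDValid S a F) : FDValid S a G := by
  simp only [FDConsts.within, Bool.and_eq_true] at h
  obtain ⟨⟨⟨⟨⟨h1, h2⟩, h3⟩, h4⟩, h5⟩, h6⟩ := h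
  exact ⟨mem_of_within h1 hF.E2, mem_of_within h2 hF.Ca, mem_of_within h3 hF.A1, mem_of_within h4 hF.Aop,
    mem_of_within h5 hF.s2, mem_of_within h6 hF.invPi2⟩

/-- Check a claimed front-door constants record (floors included). [cite: Moore1966, Ch. 3 (interval arithmetic: inclusion property)] -/
def checkFDConsts (prm : Params) (C : Consts) (nks : ℕ) (ns : List ℕ) (G : FDConsts) : Bool :=
  checkFloors C.A C.lens ns nks &&
    match fdConsts prm C nks ns with
    | some F => FDConsts.within F G
    | none => false

/-- **Soundness of `checkFDConsts`.** [cite: Moore1966, Ch. 3 (interval arithmetic: inclusion property)] -/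
theorem fdValid_of_check (hS : 0 < prm.S) (hks : PrimeData a ks) (hC : ConstsValid prm.S a ks C)
    {ns : List ℕ} {G : FDConsts} (h : checkFDConsts prm C ks.length ns G = true) : FDValid prm.S a G := by
  unfold checkFDConsts at h
  simp only [Bool.and_eq_true] at h
  obtain ⟨hfl, hF⟩ := h
  split at hF
  · rename_i F hFe; exact FDValid.of_within hF (fdValid_of_fdConsts hS hks hC hfl hFe)
  · simp at hF

/-! ## Far-diagonal lower bounds (`h0e`, `hd0e`, `hwe`; `h0o`, `hd0o`, `hwo`) -/

/-- A rational square-root majorant: `(p/q)² ≥ num/den`. [cite: Moore1966, Ch. 3 (interval arithmetic: inclusion property)] -/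
def checkSqrtUpper (num den p q : ℕ) : Bool :=
  decide (0 < q) && decide (0 < den) && decide (num * q ^ 2 ≤ p ^ 2 * den)

/-- [cite: Moore1966, Ch. 3 (interval arithmetic: inclusion property)] -/
theorem sqrt_le_of_check {num den p q : ℕ} (h : checkSqrtUpper num den p q = true) :
    Real.sqrt ((num : ℝ) / den) ≤ (p : ℝ) / q := by
  simp only [checkSqrtUpper, Bool.and_eq_true, decide_eq_true_eq] at h
  obtain ⟨⟨hq, hden⟩, hle⟩ := h
  have hq' : (0 : ℝ) < q := by exact_mod_cast hq
  have hden' : (0 : ℝ) < den := by exact_mod_cast hden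
  have hle' : (num : ℝ) * (q : ℝ) ^ 2 ≤ (p : ℝ) ^ 2 * den := by exact_mod_cast hle
  rw [Real.sqrt_le_left (by positivity), div_pow, div_le_div_iff₀ hden' (by positivity)]
  linarith

/-- Box of the even far-diagonal minorant `(Re ψ − log π)/2 − Ca/(π²m²) − 1/(8m) − (Ca/π²)·(p/q) − A_op⁺/2`
(`p/q ≥ √(8/(Be−1))`). [cite: Yoshida1992HermitianForms, §7 pp. 305–312] -/
def devEvenBox (S : ℕ) (C : Consts) (F : FDConsts) (R : IdxRec) (m p q : ℕ) : MI :=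
  (((((R.reP.sub C.logPi).divNat 2).sub ((F.Ca.mul S F.invPi2).divNat (m * m))).sub (MI.ofFrac S 1 (8 * m))).sub
    ((F.Ca.mul S F.invPi2).mul S (MI.ofFrac S p q))).sub (F.Aop.divNat 2)

/-- **Lower bound of the even far diagonal**: `(devEvenBox …).lo ≤ d̂⁺(m)·S`. [cite: Yoshida1992HermitianForms, §7 pp. 305–312] -/
theorem devEvenBox_lo_le (hS : 0 < S) (ha0 : 0 < a) (hC : ConstsValid S a ks C) {F : FDConsts} (hF : FDValid S a F)
    {R : IdxRec} {m : ℕ} (hR : MI.mem S (reDigammaQuarter (freq a m)) R.reP) (hm : 0 < m) {Be p q : ℕ}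
    (hsq : checkSqrtUpper 8 (Be - 1) p q = true) :
    ((devEvenBox S C F R m p q).lo : ℝ) ≤ devEven a Be m * S := by
  have hq : 0 < q := by
    simp only [checkSqrtUpper, Bool.and_eq_true, decide_eq_true_eq] at hsq; exact hsq.1.1
  set Ca := a * (1 + weilArchDensity (2 * a)) with hCa
  have hCa0 : 0 ≤ Ca := by
    have := weilArchDensity_pos (show 0 < 2 * a by positivity); rw [hCa]; positivity
  have hY : MI.mem S ((reDigammaQuarter (freq a m) - Real.log π) / 2 - Ca * (1 / π ^ 2) / (m * m : ℕ)
      - 1 / (8 * m : ℕ) - Ca * (1 / π ^ 2) * ((p : ℝ) / q) - primeOp a / 2) (devEvenBox S C F R m p q) := by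
    unfold devEvenBox
    refine MI.mem_sub (MI.mem_sub (MI.mem_sub (MI.mem_sub ?_ ?_) ?_) ?_) ?_
    · exact mem_of_eq (MI.mem_divNat (MI.mem_sub hR hC.logPi) (n := 2) (by norm_num)) (by norm_num)
    · exact MI.mem_divNat (MI.mem_mul hS hF.Ca hF.invPi2) (by positivity)
    · exact mem_of_eq (MI.mem_ofFrac S 1 (q := 8 * m) (by omega)) (by push_cast; ring)
    · exact mem_of_eq (MI.mem_mul hS (MI.mem_mul hS hF.Ca hF.invPi2) (MI.mem_ofFrac S p hq)) (by push_cast; ring)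
    · exact mem_of_eq (MI.mem_divNat hF.Aop (n := 2) (by norm_num)) (by norm_num)
  have hle : (reDigammaQuarter (freq a m) - Real.log π) / 2 - Ca * (1 / π ^ 2) / (m * m : ℕ)
      - 1 / (8 * m : ℕ) - Ca * (1 / π ^ 2) * ((p : ℝ) / q) - primeOp a / 2 ≤ devEven a Be m := by
    unfold devEven primeOp
    have hs := sqrt_le_of_check hsq
    push_cast at hs ⊢
    have h1 : Ca * (1 / π ^ 2) * Real.sqrt (8 / ((Be - 1 : ℕ) : ℝ)) ≤ Ca * (1 / π ^ 2) * ((p : ℝ) / q) :=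
      mul_le_mul_of_nonneg_left (by exact_mod_cast hs) (by positivity)
    have e1 : Ca * (1 / π ^ 2) / ((m : ℝ) * m) = a * (1 + weilArchDensity (2 * a)) / (π ^ 2 * m ^ 2) := by
      rw [hCa]; field_simp
    have e2 : Ca * (1 / π ^ 2) * Real.sqrt (8 / ((Be - 1 : ℕ) : ℝ))
        = a * (1 + weilArchDensity (2 * a)) / π ^ 2 * Real.sqrt (8 / ((Be - 1 : ℕ) : ℝ)) := by rw [hCa]; ring
    rw [e1] ; linarith [h1, e2]
  have hSr : (0 : ℝ) < S := by exact_mod_cast hS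
  exact hY.1.trans (by nlinarith)

/-- Box of the odd far-diagonal minorant (core − π/4 form; `p/q ≥ √(8/Bo)`). [cite: Yoshida1992HermitianForms, §7 pp. 305–312] -/
def devOddBox (S : ℕ) (C : Consts) (F : FDConsts) (R : IdxRec) (l Bo p q : ℕ) : MI :=
  (((((((R.reP.sub C.logPi).divNat 2).sub (MI.ofFrac S 1 (8 * (l + 1)))).sub
    ((F.Ca.mul S F.invPi2).divNat ((l + 1) * (l + 1)))).sub (C.P.divNat 4)).sub
      ((F.Ca.mul S F.invPi2).mul S (MI.ofFrac S p q))).sub (F.Aop.divNat 2)).sub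
        (((F.s2.mul S C.A).mul S F.invPi2).divNat Bo)

/-- **Lower bound of the odd far diagonal (core − π/4)**: `(devOddBox …).lo ≤ devOdd0·S` (record at mode `l + 1`).
[cite: Yoshida1992HermitianForms, §7 pp. 305–312] -/
theorem devOddBox_lo_le (hS : 0 < S) (ha0 : 0 < a) (hC : ConstsValid S a ks C) {F : FDConsts} (hF : FDValid S a F)
    {R : IdxRec} {l : ℕ} (hR : MI.mem S (reDigammaQuarter (freq a ((l : ℤ) + 1))) R.reP) {Bo p q : ℕ} (hBo : 0 < Bo)
    (hsq : checkSqrtUpper 8 Bo p q = true) :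
    ((devOddBox S C F R l Bo p q).lo : ℝ) ≤ devOdd0 a Bo l * S := by
  have hq : 0 < q := by
    simp only [checkSqrtUpper, Bool.and_eq_true, decide_eq_true_eq] at hsq; exact hsq.1.1
  set Ca := a * (1 + weilArchDensity (2 * a)) with hCa
  have hCa0 : 0 ≤ Ca := by
    have := weilArchDensity_pos (show 0 < 2 * a by positivity); rw [hCa]; positivity
  set s2 := (Real.exp (a / 2) - Real.exp (-(a / 2))) ^ 2 with hs2
  have hY : MI.mem S ((reDigammaQuarter (freq a ((l : ℤ) + 1)) - Real.log π) / 2 - 1 / (8 * (l + 1) : ℕ)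
      - Ca * (1 / π ^ 2) / ((l + 1) * (l + 1) : ℕ) - π / 4 - Ca * (1 / π ^ 2) * ((p : ℝ) / q) - primeOp a / 2
      - s2 * a * (1 / π ^ 2) / Bo) (devOddBox S C F R l Bo p q) := by
    unfold devOddBox
    refine MI.mem_sub (MI.mem_sub (MI.mem_sub (MI.mem_sub (MI.mem_sub (MI.mem_sub ?_ ?_) ?_) ?_) ?_) ?_) ?_
    · exact mem_of_eq (MI.mem_divNat (MI.mem_sub hR hC.logPi) (n := 2) (by norm_num)) (by norm_num)
    · exact mem_of_eq (MI.mem_ofFrac S 1 (q := 8 * (l + 1)) (by omega)) (by push_cast; ring)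
    · exact MI.mem_divNat (MI.mem_mul hS hF.Ca hF.invPi2) (by positivity)
    · exact mem_of_eq (MI.mem_divNat hC.pi (n := 4) (by norm_num)) (by norm_num)
    · exact mem_of_eq (MI.mem_mul hS (MI.mem_mul hS hF.Ca hF.invPi2) (MI.mem_ofFrac S p hq)) (by push_cast; ring)
    · exact mem_of_eq (MI.mem_divNat hF.Aop (n := 2) (by norm_num)) (by norm_num)
    · exact mem_of_eq (MI.mem_divNat (MI.mem_mul hS (MI.mem_mul hS hF.s2 hC.ha) hF.invPi2) hBo) (by ring)
  have hle : (reDigammaQuarter (freq a ((l : ℤ) + 1)) - Real.log π) / 2 - 1 / (8 * (l + 1) : ℕ)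
      - Ca * (1 / π ^ 2) / ((l + 1) * (l + 1) : ℕ) - π / 4 - Ca * (1 / π ^ 2) * ((p : ℝ) / q) - primeOp a / 2
      - s2 * a * (1 / π ^ 2) / Bo ≤ devOdd0 a Bo l := by
    unfold devOdd0 primeOp
    have hs := sqrt_le_of_check hsq
    have h1 : Ca * (1 / π ^ 2) * Real.sqrt (8 / (Bo : ℝ)) ≤ Ca * (1 / π ^ 2) * ((p : ℝ) / q) :=
      mul_le_mul_of_nonneg_left (by exact_mod_cast hs) (by positivity)
    have hl0 : (0 : ℝ) < (l : ℝ) + 1 := by positivity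
    have e1 : Ca * (1 / π ^ 2) / (((l + 1) * (l + 1) : ℕ) : ℝ) = a * (1 + weilArchDensity (2 * a)) / (π ^ 2 * ((l : ℝ) + 1) ^ 2) := by
      rw [hCa]; push_cast; field_simp
    have e2 : (1 : ℝ) / ((8 * (l + 1) : ℕ) : ℝ) = 1 / (8 * ((l : ℝ) + 1)) := by push_cast; ring
    have e3 : Ca * (1 / π ^ 2) * Real.sqrt (8 / (Bo : ℝ)) = a * (1 + weilArchDensity (2 * a)) / π ^ 2 * Real.sqrt (8 / Bo) := by
      rw [hCa]; ring
    have e4 : s2 * a * (1 / π ^ 2) / Bo = (Real.exp (a / 2) - Real.exp (-(a / 2))) ^ 2 * a / (π ^ 2 * Bo) := by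
      rw [hs2]; field_simp
    rw [e1, e2, e4]; linarith [h1, e3]
  have hSr : (0 : ℝ) < S := by exact_mod_cast hS
  exact hY.1.trans (by nlinarith)

/-! ## The tail matrices `U₂⁺`, `U₂⁻` (θ = 1) -/

/-- `κ⁺(i) = s²a/π² + 2iA₁/π + i/2 + 8Ca/(3π²)`. [cite: Moore1966, Ch. 3 (interval arithmetic: inclusion property)] -/
def kappaEvenBox (S : ℕ) (C : Consts) (F : FDConsts) (i : ℕ) : MI :=
  ((((F.s2.mul S C.A).mul S F.invPi2).add (((F.A1.mul S C.invPi).mulInt (2 * (i : ℤ))))).add (MI.ofFrac S i 2)).add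
    (((F.Ca.mul S F.invPi2).mulInt 8).divNat 3)

/-- [cite: Moore1966, Ch. 3 (interval arithmetic: inclusion property)] -/
theorem mem_kappaEvenBox (hS : 0 < S) (hC : ConstsValid S a ks C) {F : FDConsts} (hF : FDValid S a F) (i : ℕ) :
    MI.mem S ((Real.exp (a / 2) - Real.exp (-(a / 2))) ^ 2 * a / π ^ 2 + 2 * i * primeMass a / π +
      ((i : ℝ) / 2 + 8 * a * (1 + weilArchDensity (2 * a)) / (3 * π ^ 2))) (kappaEvenBox S C F i) := by
  unfold kappaEvenBox
  have h := MI.mem_add (MI.mem_add (MI.mem_add (MI.mem_mul hS (MI.mem_mul hS hF.s2 hC.ha) hF.invPi2)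
    (MI.mem_mulInt (MI.mem_mul hS hF.A1 hC.invPi) (2 * (i : ℤ)))) (MI.mem_ofFrac S (i : ℤ) (q := 2) (by norm_num)))
    (MI.mem_divNat (MI.mem_mulInt (MI.mem_mul hS hF.Ca hF.invPi2) 8) (n := 3) (by norm_num))
  refine mem_of_eq h ?_
  push_cast
  field_simp
  ring

/-- `U₂⁺(i,j)` box with `θ = 1`, `d0 = d0z·2^{−cd}`. [cite: Yoshida1992HermitianForms, §7 pp. 305–312] -/
def u2EvenBox (S : ℕ) (C : Consts) (F : FDConsts) (cd d0z Be B3e : ℕ) (i j : ℕ) : MI :=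
  let q1 := ((((MI.ofInt S 1).add ((F.A1.mul S C.invPi).mulInt 4)).divNat 4).sqr S).mulInt (2 ^ cd)
  let t1 := (q1.divNat (d0z * (B3e - 1))).mulInt (2 * sgn (i : ℤ) (j : ℤ))
  if i = j then t1.add (((((kappaEvenBox S C F i).sqr S).mulInt (2 * 2 ^ cd * (Be : ℤ))).divNat (d0z * (B3e * B3e * (B3e - 1)))))
  else t1

/-- **`u2EvenBox ∋ U₂⁺(i,j)`** (θ = 1, `d0 = d0z/2^cd`, `B3e ≥ 2`, `d0z > 0`). [cite: Yoshida1992HermitianForms, §7 pp. 305–312] -/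
theorem mem_u2EvenBox (hS : 0 < S) (hC : ConstsValid S a ks C) {F : FDConsts} (hF : FDValid S a F)
    {cd d0z Be B3e : ℕ} (hd0 : 0 < d0z) (hB3 : 2 ≤ B3e) (i j : ℕ) :
    MI.mem S (U2Even a 1 ((d0z : ℝ) * (1 / 2 ^ cd)) Be B3e i j) (u2EvenBox S C F cd d0z Be B3e i j) := by
  have hpm : primeMass a = ∑ k ∈ weilPrimeIndex a, (Λ k : ℝ) / Real.sqrt k := rfl
  have hq1 : MI.mem S (((1 + 4 / π * primeMass a) / 4) ^ 2 * 2 ^ cd)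
      (((((MI.ofInt S 1).add ((F.A1.mul S C.invPi).mulInt 4)).divNat 4).sqr S).mulInt (2 ^ cd)) := by
    have h := MI.mem_mulInt (MI.mem_sqr hS (MI.mem_divNat (MI.mem_add (MI.mem_ofInt S 1)
      (MI.mem_mulInt (MI.mem_mul hS hF.A1 hC.invPi) 4)) (n := 4) (by norm_num))) (2 ^ cd)
    refine mem_of_eq h ?_; push_cast; ring
  have hB31 : 0 < B3e - 1 := by omega
  have ht1 : MI.mem S ((1 + 1) * ((1 + 4 / π * primeMass a) / 4) ^ 2 / ((d0z : ℝ) * (1 / 2 ^ cd) * ((B3e - 1 : ℕ) : ℝ)) *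
      ((-1 : ℝ) ^ i * (-1 : ℝ) ^ j))
      ((((((((MI.ofInt S 1).add ((F.A1.mul S C.invPi).mulInt 4)).divNat 4).sqr S).mulInt (2 ^ cd)).divNat
        (d0z * (B3e - 1))).mulInt (2 * sgn (i : ℤ) (j : ℤ)))) := by
    have h := MI.mem_mulInt (MI.mem_divNat hq1 (n := d0z * (B3e - 1)) (Nat.mul_pos hd0 hB31)) (2 * sgn (i : ℤ) (j : ℤ))
    refine mem_of_eq h ?_
    have hsg : ((-1 : ℝ) ^ i * (-1 : ℝ) ^ j) = (sgn (i : ℤ) (j : ℤ) : ℝ) := by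
      rw [← neg_one_zpow_eq_sgn, ← zpow_natCast, ← zpow_natCast, ← zpow_add₀ (by norm_num)]
    rw [hsg]
    have hd : (0 : ℝ) < d0z := by exact_mod_cast hd0
    have hb : (0 : ℝ) < ((B3e - 1 : ℕ) : ℝ) := by exact_mod_cast hB31
    push_cast
    field_simp
    ring
  unfold u2EvenBox U2Even
  simp only
  by_cases hij : i = j
  · subst hij
    simp only [if_true]
    rw [← hpm]
    have hκ := mem_kappaEvenBox hS hC hF i
    have hB3 : (0 : ℝ) < B3e := by exact_mod_cast (show 0 < B3e by omega)
    have h2 := MI.mem_divNat (MI.mem_mulInt (MI.mem_sqr hS hκ) (2 * 2 ^ cd * (Be : ℤ)))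
      (n := d0z * (B3e * B3e * (B3e - 1))) (Nat.mul_pos hd0 (Nat.mul_pos (Nat.mul_pos (by omega) (by omega)) hB31))
    refine mem_of_eq (MI.mem_add ht1 h2) ?_
    have hd : (0 : ℝ) < d0z := by exact_mod_cast hd0
    have hb : (0 : ℝ) < ((B3e - 1 : ℕ) : ℝ) := by exact_mod_cast hB31
    push_cast
    field_simp
    ring
  · simp only [hij, if_false, add_zero]
    rw [← hpm]
    exact ht1

/-- `Σ_{i<k} wts_i · Im cs_i` (the prime sine sum at one mode). [cite: Moore1966, Ch. 3 (interval arithmetic: inclusion property)] -/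
def sinSum (S : ℕ) (wts : List MI) (cs : List MC) : ℕ → MI
  | 0 => MI.ofInt S 0
  | i + 1 => (sinSum S wts cs i).add ((wts.getD i default).mul S (cs.getD i default).im)

/-- [cite: Moore1966, Ch. 3 (interval arithmetic: inclusion property)] -/
theorem mem_sinSum (hS : 0 < S) (hC : ConstsValid S a ks C) {n : ℤ} {R : IdxRec} (hR : OffValid S a ks n R) :
    ∀ k, k ≤ ks.length → MI.mem S (∑ i ∈ Finset.range k, (ks.getD i default).wt *
      Real.sin (freq a n * (ks.getD i default).len)) (sinSum S C.wts R.cs k)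
  | 0, _ => by simpa [sinSum] using MI.mem_ofInt S 0
  | k + 1, hk => by
      rw [Finset.sum_range_succ, sinSum]
      have hk' : k < ks.length := hk
      have hsn : MI.mem S (Real.sin (freq a n * (ks.getD k default).len)) (R.cs.getD k default).im := by
        have := (hR.cs k hk').2
        rwa [Complex.exp_ofReal_mul_I_im] at this
      exact MI.mem_add (mem_sinSum hS hC hR k (by omega)) (MI.mem_mul hS (hC.wts k hk') hsn)

/-- `v⁻(k)` box from the record at mode `k + 1`. [cite: Yoshida1992HermitianForms, §7 pp. 305–312] -/
def vOddBox (S : ℕ) (C : Consts) (F : FDConsts) (R : IdxRec) (k : ℕ) : MI :=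
  ((((((F.s2.mul S (R.om.mul S R.c)).mul S C.invPi).mulInt (-4)).sub ((sinSum S C.wts R.cs C.wts.length).mul S C.invPi)).sub
    ((R.imP.mul S C.invPi).divNat 2)).add (R.eS.mul S C.invPi)).mulInt (sgn ((k : ℤ) + 1) 0)

/-- **`vOddBox ∋ v⁻(k)`** (record valid at mode `k + 1`). [cite: Yoshida1992HermitianForms, §7 pp. 305–312] -/
theorem mem_vOddBox (hS : 0 < S) (hks : PrimeData a ks) (hC : ConstsValid S a ks C) {F : FDConsts} (hF : FDValid S a F)
    {k : ℕ} {R : IdxRec} (hR : OffValid S a ks ((k : ℤ) + 1) R) :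
    MI.mem S (vOdd a k) (vOddBox S C F R k) := by
  unfold vOdd vOddBox
  have hsin : ∑ j ∈ weilPrimeIndex a, (Λ j : ℝ) / Real.sqrt j * Real.sin (freq a ((k : ℤ) + 1) * Real.log j)
      = ∑ i ∈ Finset.range ks.length, (ks.getD i default).wt * Real.sin (freq a ((k : ℤ) + 1) * (ks.getD i default).len) := by
    rw [sum_weilPrimeIndex_eq_listSum hks, list_sum_map_eq_sum_range]
    refine Finset.sum_congr rfl fun i _ ↦ by rw [PrimeLen.log_val]
  rw [hsin, hC.wts_len]
  have hss := mem_sinSum hS hC hR ks.length le_rfl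
  have h := MI.mem_mulInt (MI.mem_add (MI.mem_sub (MI.mem_sub
    (MI.mem_mulInt (MI.mem_mul hS (MI.mem_mul hS hF.s2 (MI.mem_mul hS hR.om hR.c)) hC.invPi) (-4))
    (MI.mem_mul hS hss hC.invPi)) (MI.mem_divNat (MI.mem_mul hS hR.imP hC.invPi) (n := 2) (by norm_num)))
    (MI.mem_mul hS hR.eS hC.invPi)) (sgn ((k : ℤ) + 1) 0)
  refine mem_of_eq h ?_
  have hsg : (-1 : ℝ) ^ (k + 1) = (sgn ((k : ℤ) + 1) 0 : ℝ) := by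
    rw [← neg_one_zpow_eq_sgn, add_zero, ← zpow_natCast]; push_cast; ring_nf
  rw [hsg]
  have hπ : (π : ℝ) ≠ 0 := Real.pi_ne_zero
  push_cast
  field_simp

/-- `κ⁻(k) = s²a²/(4π³) + 2(k+1)A₁/π + (k+1)/2 + 4Ca/(3π²)`. [cite: Moore1966, Ch. 3 (interval arithmetic: inclusion property)] -/
def kappaOddBox (S : ℕ) (C : Consts) (F : FDConsts) (k : ℕ) : MI :=
  ((((((F.s2.mul S (C.A.sqr S)).mul S F.invPi2).mul S C.invPi).divNat 4).add
    ((F.A1.mul S C.invPi).mulInt (2 * ((k : ℤ) + 1)))).add (MI.ofFrac S ((k : ℤ) + 1) 2)).add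
      (((F.Ca.mul S F.invPi2).mulInt 4).divNat 3)

/-- [cite: Moore1966, Ch. 3 (interval arithmetic: inclusion property)] -/
theorem mem_kappaOddBox (hS : 0 < S) (hC : ConstsValid S a ks C) {F : FDConsts} (hF : FDValid S a F) (k : ℕ) :
    MI.mem S ((Real.exp (a / 2) - Real.exp (-(a / 2))) ^ 2 * a ^ 2 / (4 * π ^ 3) + 2 * ((k : ℕ) + 1 : ℕ) * primeMass a / π +
      ((((k : ℕ) + 1 : ℕ) : ℝ) / 2 + 4 * a * (1 + weilArchDensity (2 * a)) / (3 * π ^ 2))) (kappaOddBox S C F k) := by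
  unfold kappaOddBox
  have h := MI.mem_add (MI.mem_add (MI.mem_add
    (MI.mem_divNat (MI.mem_mul hS (MI.mem_mul hS (MI.mem_mul hS hF.s2 (MI.mem_sqr hS hC.ha)) hF.invPi2) hC.invPi)
      (n := 4) (by norm_num))
    (MI.mem_mulInt (MI.mem_mul hS hF.A1 hC.invPi) (2 * ((k : ℤ) + 1))))
    (MI.mem_ofFrac S ((k : ℤ) + 1) (q := 2) (by norm_num)))
    (MI.mem_divNat (MI.mem_mulInt (MI.mem_mul hS hF.Ca hF.invPi2) 4) (n := 3) (by norm_num))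
  refine mem_of_eq h ?_
  push_cast
  field_simp
  ring

/-- `U₂⁻(k,k')` box with `θ = 1`, `d0 = d0z·2^{−cd}` (records at modes `k+1`, `k'+1` from the table).
[cite: Yoshida1992HermitianForms, §7 pp. 305–312] -/
def u2OddBox (S : ℕ) (C : Consts) (F : FDConsts) (tab : List IdxRec) (cd d0z Bo B3o : ℕ) (k k' : ℕ) : MI :=
  let t1 := ((((vOddBox S C F (tget tab (k + 1)) k).mul S (vOddBox S C F (tget tab (k' + 1)) k')).mulInt
    (2 * 2 ^ cd)).divNat (d0z * B3o))
  if k = k' then t1.add (((((kappaOddBox S C F k).sqr S).mulInt (2 * 2 ^ cd * (Bo : ℤ))).divNat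
    (d0z * ((B3o + 1) * (B3o + 1) * B3o))))
  else t1

/-- **`u2OddBox ∋ U₂⁻(k,k')`** (θ = 1; table valid below `N` with `k+1, k'+1 < N`). [cite: Yoshida1992HermitianForms, §7 pp. 305–312] -/
theorem mem_u2OddBox (hS : 0 < S) (hks : PrimeData a ks) (hC : ConstsValid S a ks C) {F : FDConsts} (hF : FDValid S a F)
    {tab : List IdxRec} {N : ℕ} (hT : TabValid S a ks N tab) {cd d0z Bo B3o : ℕ} (hd0 : 0 < d0z) (hB3 : 1 ≤ B3o)
    {k k' : ℕ} (hk : k + 1 < N) (hk' : k' + 1 < N) :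
    MI.mem S (U2Odd a 1 ((d0z : ℝ) * (1 / 2 ^ cd)) Bo B3o k k') (u2OddBox S C F tab cd d0z Bo B3o k k') := by
  have hpm : primeMass a = ∑ k ∈ weilPrimeIndex a, (Λ k : ℝ) / Real.sqrt k := rfl
  have ek : (((k + 1 : ℕ) : ℤ)) = (k : ℤ) + 1 := by push_cast; ring
  have ek' : (((k' + 1 : ℕ) : ℤ)) = (k' : ℤ) + 1 := by push_cast; ring
  have hRk := (hT (k + 1) hk).1
  have hRk' := (hT (k' + 1) hk').1
  rw [ek] at hRk
  rw [ek'] at hRk'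
  have hv := MI.mem_mul hS (mem_vOddBox hS hks hC hF hRk) (mem_vOddBox hS hks hC hF hRk')
  have hd : (0 : ℝ) < d0z := by exact_mod_cast hd0
  have hB : (0 : ℝ) < B3o := by exact_mod_cast hB3
  have ht1 : MI.mem S ((1 + 1) * (1 / ((d0z : ℝ) * (1 / 2 ^ cd) * B3o)) * (vOdd a k * vOdd a k'))
      (((((vOddBox S C F (tget tab (k + 1)) k).mul S (vOddBox S C F (tget tab (k' + 1)) k')).mulInt
        (2 * 2 ^ cd)).divNat (d0z * B3o))) := by
    have h := MI.mem_divNat (MI.mem_mulInt hv (2 * 2 ^ cd)) (n := d0z * B3o) (Nat.mul_pos hd0 (by omega))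
    refine mem_of_eq h ?_
    push_cast
    field_simp
    ring
  unfold u2OddBox U2Odd
  simp only
  by_cases hkk : k = k'
  · subst hkk
    simp only [if_true]
    rw [← hpm]
    have hκ := mem_kappaOddBox hS hC hF k
    have h2 := MI.mem_divNat (MI.mem_mulInt (MI.mem_sqr hS hκ) (2 * 2 ^ cd * (Bo : ℤ)))
      (n := d0z * ((B3o + 1) * (B3o + 1) * B3o)) (Nat.mul_pos hd0 (Nat.mul_pos (Nat.mul_pos (by omega) (by omega)) (by omega)))
    refine mem_of_eq (MI.mem_add ht1 h2) ?_
    push_cast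
    field_simp
    ring
  · simp only [hkk, if_false, add_zero]
    exact ht1

/-! ## Bridges between the `Fin`-indexed verbatim tail matrices and `U2Even`/`U2Odd` -/

/-- The front door's inline `U₂⁺` (indices in `Fin Be`) is `U2Even`. [cite: Yoshida1992HermitianForms, §7 pp. 305–312] -/
theorem U2Even_fin (a θ d0 : ℝ) {Be : ℕ} (B3e : ℕ) (i j : Fin Be) :
    ((1 + θ) * ((1 + 4 / π * (∑ k ∈ weilPrimeIndex a, (Λ k : ℝ) / Real.sqrt k)) / 4) ^ 2 / (d0 * ((B3e - 1 : ℕ) : ℝ)) *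
        ((-1 : ℝ) ^ (i : ℕ) * (-1 : ℝ) ^ (j : ℕ)) +
      (if i = j then (1 + θ⁻¹) * (Be / (d0 * ((B3e : ℝ) ^ 2 * ((B3e - 1 : ℕ) : ℝ)))) *
        ((Real.exp (a / 2) - Real.exp (-(a / 2))) ^ 2 * a / π ^ 2 +
          2 * (i : ℕ) * (∑ k ∈ weilPrimeIndex a, (Λ k : ℝ) / Real.sqrt k) / π +
            (((i : ℕ) : ℝ) / 2 + 8 * a * (1 + weilArchDensity (2 * a)) / (3 * π ^ 2))) ^ 2 else 0))
    = U2Even a θ d0 Be B3e i j := by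
  unfold U2Even
  by_cases h : i = j
  · subst h; simp
  · have h' : (i : ℕ) ≠ (j : ℕ) := fun e ↦ h (Fin.ext e)
    simp [h, h']

/-- The front door's inline `U₂⁻` (indices in `Fin Bo`) is `U2Odd`. [cite: Yoshida1992HermitianForms, §7 pp. 305–312] -/
theorem U2Odd_fin (a θ d0 : ℝ) {Bo : ℕ} (B3o : ℕ) (k k' : Fin Bo) :
    ((1 + θ) * (1 / (d0 * B3o)) *
        (((-1 : ℝ) ^ ((k : ℕ) + 1) * (-(4 * (Real.exp (a / 2) - Real.exp (-(a / 2))) ^ 2 *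
            (freq a (((k : ℕ) : ℤ) + 1) / (1 + 4 * freq a (((k : ℕ) : ℤ) + 1) ^ 2)) / π) -
            (∑ j ∈ weilPrimeIndex a, (Λ j : ℝ) / Real.sqrt j * Real.sin (freq a (((k : ℕ) : ℤ) + 1) * Real.log j)) / π -
            (Complex.digamma (1 / 4 + ((freq a (((k : ℕ) : ℤ) + 1) : ℝ) : ℂ) / 2 * I)).im / (2 * π) +
            archExpSumSin a (((k : ℕ) : ℤ) + 1) / π)) *
          ((-1 : ℝ) ^ ((k' : ℕ) + 1) * (-(4 * (Real.exp (a / 2) - Real.exp (-(a / 2))) ^ 2 *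
            (freq a (((k' : ℕ) : ℤ) + 1) / (1 + 4 * freq a (((k' : ℕ) : ℤ) + 1) ^ 2)) / π) -
            (∑ j ∈ weilPrimeIndex a, (Λ j : ℝ) / Real.sqrt j * Real.sin (freq a (((k' : ℕ) : ℤ) + 1) * Real.log j)) / π -
            (Complex.digamma (1 / 4 + ((freq a (((k' : ℕ) : ℤ) + 1) : ℝ) : ℂ) / 2 * I)).im / (2 * π) +
            archExpSumSin a (((k' : ℕ) : ℤ) + 1) / π))) +
      (if k = k' then (1 + θ⁻¹) * (Bo / (d0 * ((((B3o : ℝ) + 1) ^ 2) * (B3o : ℝ)))) *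
        ((Real.exp (a / 2) - Real.exp (-(a / 2))) ^ 2 * a ^ 2 / (4 * π ^ 3) + 2 * ((k : ℕ) + 1 : ℕ) *
          (∑ j ∈ weilPrimeIndex a, (Λ j : ℝ) / Real.sqrt j) / π +
            ((((k : ℕ) + 1 : ℕ) : ℝ) / 2 + 4 * a * (1 + weilArchDensity (2 * a)) / (3 * π ^ 2))) ^ 2 else 0))
    = U2Odd a θ d0 Bo B3o k k' := by
  unfold U2Odd vOdd
  by_cases h : k = k'
  · subst h; simp
  · have h' : (k : ℕ) ≠ (k' : ℕ) := fun e ↦ h (Fin.ext e)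
    simp [h, h']

/-! ## Packaging: the front door's `hS` hypotheses, verbatim, from the kernel checks -/

/-- The even front-door matrix entry equals `frontEntry` (constant weight `w = wz·2^{−cd}`, `K = B3e − Be`, θ = 1).
[cite: Yoshida1992HermitianForms, §7 pp. 305–312] -/
theorem even_entry_eq_frontEntry (a : ℝ) (Be B3e : ℕ) (cd wz d0z : ℕ) (i j : Fin Be) :
    ((if (i : ℕ) = 0 then gramCoeff a 0 j else if (j : ℕ) = 0 then gramCoeff a i 0
        else (gramCoeff a i j + gramCoeff a i (-(j : ℤ))) / 2)
      - (∑ m ∈ Finset.Ico Be B3e, (if (i : ℕ) = 0 then gramCoeff a 0 m else if m = 0 then gramCoeff a i 0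
          else (gramCoeff a i m + gramCoeff a i (-(m : ℤ))) / 2) *
          (if (j : ℕ) = 0 then gramCoeff a 0 m else if m = 0 then gramCoeff a j 0
          else (gramCoeff a j m + gramCoeff a j (-(m : ℤ))) / 2) / ((fun _ : ℕ ↦ (wz : ℝ) * (1 / 2 ^ cd)) m))
      - U2Even a 1 ((d0z : ℝ) * (1 / 2 ^ cd)) Be B3e i j)
    = frontEntry (sectorKernel false (gramCoeff a)) Be (B3e - Be) cd wz
        (fun i j ↦ U2Even a 1 ((d0z : ℝ) * (1 / 2 ^ cd)) Be B3e i j) i j := by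
  unfold frontEntry
  simp only [sectorKernel, evenKernel, Bool.false_eq_true, if_false]
  congr 1
  congr 1
  rw [Finset.sum_Ico_eq_sum_range]

/-- The odd front-door matrix entry equals `frontEntry`. [cite: Yoshida1992HermitianForms, §7 pp. 305–312] -/
theorem odd_entry_eq_frontEntry (a : ℝ) (Bo B3o : ℕ) (cd wz d0z : ℕ) (k k' : Fin Bo) :
    ((((gramCoeff a (((k : ℕ) : ℤ) + 1) (((k' : ℕ) : ℤ) + 1) - gramCoeff a (((k : ℕ) : ℤ) + 1) (-(((k' : ℕ) : ℤ) + 1))) / 2)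
      - (∑ l ∈ Finset.Ico Bo B3o, ((gramCoeff a (((k : ℕ) : ℤ) + 1) ((l : ℤ) + 1) - gramCoeff a (((k : ℕ) : ℤ) + 1) (-((l : ℤ) + 1))) / 2) *
          ((gramCoeff a (((k' : ℕ) : ℤ) + 1) ((l : ℤ) + 1) - gramCoeff a (((k' : ℕ) : ℤ) + 1) (-((l : ℤ) + 1))) / 2) /
            ((fun _ : ℕ ↦ (wz : ℝ) * (1 / 2 ^ cd)) l))
      - U2Odd a 1 ((d0z : ℝ) * (1 / 2 ^ cd)) Bo B3o k k'))
    = frontEntry (sectorKernel true (gramCoeff a)) Bo (B3o - Bo) cd wz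
        (fun k k' ↦ U2Odd a 1 ((d0z : ℝ) * (1 / 2 ^ cd)) Bo B3o k k') k k' := by
  unfold frontEntry
  simp only [sectorKernel, oddKernel, if_true]
  congr 1
  congr 1
  rw [Finset.sum_Ico_eq_sum_range]

/-- **EVEN `hS` of the front door** from the kernel checks: the light-table column list, the Schur-row check
against `DS` (all rows in one band here; bands are combined by the caller) and a `PsdDyadic` certificate on `DS`.
[cite: Yoshida1992HermitianForms, §7 pp. 305–312] -/
theorem even_front_near (hS : 0 < S) (ha0 : 0 < a) (hks : PrimeData a ks) (hC : ConstsValid S a ks C)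
    {F : FDConsts} (hF : FDValid S a F) {tab ctab : List IdxRec} {Be B3e : ℕ} (hBe : 1 ≤ Be) (hBB : Be ≤ B3e)
    (hB3 : 2 ≤ B3e) (hT : TabValid S a ks (Be + 1) tab) (hCT : TabColValid S a ks Be (B3e + 1) ctab)
    {c cd wz d0z : ℕ} (hd0 : 0 < d0z) {ρS : ℤ} {DS : List (List ℤ)} {i0 k : ℕ}
    (h : checkFrontRowsAux S c ρS C tab false Be (colList false S C tab ctab Be (B3e - Be)) cd wz (B3e - Be)
      (u2EvenBox S C F cd d0z Be B3e) DS i0 k = true)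
    (i j : Fin Be) (hi : i0 ≤ i) (hik : (i : ℕ) < i0 + k) :
    |((if (i : ℕ) = 0 then gramCoeff a 0 j else if (j : ℕ) = 0 then gramCoeff a i 0
        else (gramCoeff a i j + gramCoeff a i (-(j : ℤ))) / 2)
      - (∑ m ∈ Finset.Ico Be B3e, (if (i : ℕ) = 0 then gramCoeff a 0 m else if m = 0 then gramCoeff a i 0
          else (gramCoeff a i m + gramCoeff a i (-(m : ℤ))) / 2) *
          (if (j : ℕ) = 0 then gramCoeff a 0 m else if m = 0 then gramCoeff a j 0
          else (gramCoeff a j m + gramCoeff a j (-(m : ℤ))) / 2) / ((fun _ : ℕ ↦ (wz : ℝ) * (1 / 2 ^ cd)) m))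
      - U2Even a 1 ((d0z : ℝ) * (1 / 2 ^ cd)) Be B3e i j)
      - (PsdDyadic.getMZ DS i j : ℝ) * (1 / 2 ^ c)| ≤ (ρS : ℝ) * (1 / 2 ^ c) := by
  rw [even_entry_eq_frontEntry a Be B3e cd wz d0z i j]
  have hcols := colsValid_colList hS ha0 hks hC hBe hT (K := B3e - Be)
    (by rw [Nat.add_sub_cancel' hBB]; exact hCT) false
  exact near_front_of_checkAux hS ha0 hks hC hT hcols
    (fun i hi j hj ↦ mem_u2EvenBox hS hC hF hd0 hB3 i j) h hi hik i.isLt j.isLt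

/-- **ODD `hS` of the front door** (table valid below `Bo + 1` covers the block modes `k + 1 ≤ Bo`).
[cite: Yoshida1992HermitianForms, §7 pp. 305–312] -/
theorem odd_front_near (hS : 0 < S) (ha0 : 0 < a) (hks : PrimeData a ks) (hC : ConstsValid S a ks C)
    {F : FDConsts} (hF : FDValid S a F) {tab ctab : List IdxRec} {Bo B3o : ℕ} (hBo : 1 ≤ Bo) (hBB : Bo ≤ B3o)
    (hT : TabValid S a ks (Bo + 1) tab) (hCT : TabColValid S a ks Bo (B3o + 1) ctab)
    {c cd wz d0z : ℕ} (hd0 : 0 < d0z) {ρS : ℤ} {DS : List (List ℤ)} {i0 k : ℕ}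
    (h : checkFrontRowsAux S c ρS C tab true Bo (colList true S C tab ctab Bo (B3o - Bo)) cd wz (B3o - Bo)
      (u2OddBox S C F tab cd d0z Bo B3o) DS i0 k = true)
    (kk kk' : Fin Bo) (hi : i0 ≤ kk) (hik : (kk : ℕ) < i0 + k) :
    |(((gramCoeff a (((kk : ℕ) : ℤ) + 1) (((kk' : ℕ) : ℤ) + 1) - gramCoeff a (((kk : ℕ) : ℤ) + 1) (-(((kk' : ℕ) : ℤ) + 1))) / 2)
      - (∑ l ∈ Finset.Ico Bo B3o, ((gramCoeff a (((kk : ℕ) : ℤ) + 1) ((l : ℤ) + 1) - gramCoeff a (((kk : ℕ) : ℤ) + 1) (-((l : ℤ) + 1))) / 2) *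
          ((gramCoeff a (((kk' : ℕ) : ℤ) + 1) ((l : ℤ) + 1) - gramCoeff a (((kk' : ℕ) : ℤ) + 1) (-((l : ℤ) + 1))) / 2) /
            ((fun _ : ℕ ↦ (wz : ℝ) * (1 / 2 ^ cd)) l))
      - U2Odd a 1 ((d0z : ℝ) * (1 / 2 ^ cd)) Bo B3o kk kk')
      - (PsdDyadic.getMZ DS kk kk' : ℝ) * (1 / 2 ^ c)| ≤ (ρS : ℝ) * (1 / 2 ^ c) := by
  rw [odd_entry_eq_frontEntry a Bo B3o cd wz d0z kk kk']
  have hcols := colsValid_colList hS ha0 hks hC hBo hT (K := B3o - Bo)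
    (by rw [Nat.add_sub_cancel' hBB]; exact hCT) true
  exact near_front_of_checkAux hS ha0 hks hC hT hcols
    (fun i hi j hj ↦ mem_u2OddBox hS hks hC hF hT hd0 (by omega) (by omega) (by omega)) h hi hik kk.isLt kk'.isLt

end Encl

end Literature.NumberTheory.LFunctions.Yoshida1992
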